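import Literature.Computability.Cryptography.HallgrenClassGroupRootSlotsFP
import Literature.Computability.Cryptography.HallgrenClassGroupIdealEnumerationMachine
import Literature.Computability.Cryptography.FactorWindowTransducer
import Literature.Computability.Cryptography.ShorAssemblyLeavesProofs
import Literature.Computability.QuantumComplexity.BQPJoinClosure
import Literature.Computability.Complexity.UniformProbBlocks
import Literature.Computability.Complexity.CoinCounting
import HarnessLib

/-!
# The torsion-witness bit language `TWBIT` is in `BQP`, given the factor bits and the order-of-a-form bits

The intermediate language of the `3 ∣ h(−d)` sampler (Hallgren 2005, §4; Cohen 1993, §5.4):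

  `TWBIT = {⟨bin d, ⟨bin a, bin k⟩⟩ : twQuery d k (withRoots (−d) (factorPairs a)) ∈ THREEORD}`,

where `twQuery` (file `HallgrenClassGroupIdealEnumerationMachine`) composes the `k`-th form of
discriminant `−d` above `a` from the prime-power slots `withRoots (−d) (factorPairs a)` — the distinct
primes of `a` with multiplicities and the least square root of `−d (mod 4q)` — and `THREEORD` is the
language "`3` divides the order of the class of the (single, reduced) form". A classical randomized
machine with the two oracles `FB` (factor bits, Shor) and `THREEORD` (Hallgren's kernel) decides it: read
the factorisation of `a` bit by bit from `FB` (`FactorWindow.exists_transducer`), compute the square roots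
of `−d` modulo the distinct primes `q_s` by Cipolla's algorithm from the coin blocks (`slotList`; on the
good event the slot list IS `withRoots`, `RootSlots.slotList_eq_withRoots`), ask `THREEORD` once. The bad
event has probability `≤ S·(3/4)^m ≤ n(3/4)^{n+10} ≤ 1/4` (`RootSlots.uniformProb_not_good_le`, a union
bound over the `S ≤ n` slots). The classical-base principle (`isQSolvable_of_mem_FPRel_BQP_holds`, BBBV
1997) and decision from the written bit give **`twbLang_mem_BQP`**.

## References

* S. Hallgren, *Fast quantum algorithms for computing the unit group and class group of a number
  field*, STOC 2005, §4 [Hallgren2005].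
* H. Cohen, *A Course in Computational Algebraic Number Theory*, GTM 138, Springer 1993, §1.5, §5.4
  [Cohen1993].
* C. H. Bennett, E. Bernstein, G. Brassard, U. Vazirani, *Strengths and weaknesses of quantum
  computing*, SIAM J. Comput. 26 (1997), Cor. 4.15 [BennettBernsteinBrassardVazirani1997].
-/

namespace Literature.Computability.Cryptography.Hallgren2005

namespace TorsionWitness

open RootSlots FormComposition Cipolla _root_.Computability Polynomial
open Literature.Computability.Complexity Literature.Computability.Complexity.Brick
  Literature.Computability.Complexity.CodeFP Literature.Computability.Cryptography.ClassBQP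
  Literature.Computability.QuantumComplexity

/-! ### The two languages -/

/-- **`THREEORD`**: codes of single-form class-group instances `(d, [q])` with `3 ∣` the order of the
class of `q`. [cite: Hallgren2005, §4] -/
def threeOrdLang : Language Bool :=
  {w | ∃ (d : ℕ) (q : ℕ × ℤ × ℕ), w = encodeClInstance d [q] ∧ IsClInstance d [q] ∧ 3 ∣ clGenOrder d [q]}

/-- **`TWBIT`**: `⟨bin d, ⟨bin a, bin k⟩⟩` such that the `k`-th form of discriminant `−d` above `a`
(as a `THREEORD` query) is in `THREEORD`. [cite: Hallgren2005, §4] -/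
def twbLang : Language Bool :=
  {x | ∃ d a k : ℕ, x = boolPair (encodeNat d) (boolPair (encodeNat a) (encodeNat k)) ∧
    twQuery d k (withRoots (-(d : ℤ)) (factorPairs a)) ∈ threeOrdLang}

/-! ### Parsing and the coin blocks -/

/-- The `d`-field of `x = ⟨bin d, ⟨bin a, bin k⟩⟩`. [folklore] -/
def dOf (x : List Bool) : ℕ := bitsToNat (fstF x)

/-- The `a`-field. [folklore] -/
def aOf (x : List Bool) : ℕ := bitsToNat (fstF (sndF x))

/-- The `k`-field. [folklore] -/
def kOf (x : List Bool) : ℕ := bitsToNat (sndF (sndF x))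

/-- Well-formedness: `x` is the code of its three fields. [folklore] -/
def wf (x : List Bool) : Bool :=
  boolPair (encodeNat (dOf x)) (boolPair (encodeNat (aOf x)) (encodeNat (kOf x))) == x

/-- `n` consecutive blocks of length `ℓ` of a string. [folklore] -/
def chunks (n ℓ : ℕ) (c : List Bool) : List (List Bool) := (List.range n).map fun i => (c.drop (i * ℓ)).take ℓ

/-- The coin blocks of the `S` slots: slot `s` gets `m = |x| + 10` attempts of `μ = |x| + 3` coins.
[folklore] -/
def blocks (x : List Bool) (S : ℕ) (c : List Bool) : List (List (List Bool)) :=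
  (chunks S ((x.length + 10) * (x.length + 3)) c).map (chunks (x.length + 10) (x.length + 3))

/-- The number whose factorisation is read: `a`, from the machine input `z = ⟨x, coins⟩`. [folklore] -/
def num (z : List Bool) : ℕ := aOf (fstF z)

/-- The final query from `(z, F)`: the `THREEORD` query built from the slot list of `F` with roots from
the coins. [cite: Hallgren2005, §4] -/
def fin (t : List Bool × List ℕ) : List Bool :=
  twQuery (dOf (fstF t.1)) (kOf (fstF t.1))
    (slotList (dOf (fstF t.1)) t.2 (blocks (fstF t.1) t.2.dedup.length (sndF t.1)))

/-- The guard bit: well-formedness of `x`. [folklore] -/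
def ok (z : List Bool) : Bool := wf (fstF z)

/-- Well-formed strings are exactly the codes of triples. [folklore] -/
theorem wf_eq_true_iff (x : List Bool) :
    wf x = true ↔ ∃ d a k : ℕ, x = boolPair (encodeNat d) (boolPair (encodeNat a) (encodeNat k)) := by
  rw [wf, beq_iff_eq]
  refine ⟨fun h => ⟨_, _, _, h.symm⟩, ?_⟩
  rintro ⟨d, a, k, rfl⟩
  simp [dOf, aOf, kOf, fstF_boolPair, sndF_boolPair, bitsToNat_encodeNat]

/-- Membership of a code in `TWBIT`. [folklore] -/
theorem mem_twbLang_iff (d a k : ℕ) :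
    boolPair (encodeNat d) (boolPair (encodeNat a) (encodeNat k)) ∈ twbLang ↔
      twQuery d k (withRoots (-(d : ℤ)) (factorPairs a)) ∈ threeOrdLang := by
  refine ⟨?_, fun h => ⟨d, a, k, rfl, h⟩⟩
  rintro ⟨d', a', k', h, hmem⟩
  have hd := congrArg (fun w => bitsToNat (fstF w)) h
  have ha := congrArg (fun w => bitsToNat (fstF (sndF w))) h
  have hk := congrArg (fun w => bitsToNat (sndF (sndF w))) h
  simp only [fstF_boolPair, sndF_boolPair, bitsToNat_encodeNat] at hd ha hk
  subst hd ha hk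
  exact hmem

/-- Members of `TWBIT` are well formed. [folklore] -/
theorem wf_of_mem {x : List Bool} (hx : x ∈ twbLang) : wf x = true := by
  obtain ⟨d, a, k, rfl, -⟩ := hx
  exact (wf_eq_true_iff _).2 ⟨d, a, k, rfl⟩

/-! ### The classical maps are polynomial time -/

/-- `fstF` on codes. [folklore] -/
private theorem fstC : CodeFP strE strE fstF := of_fn fstF fstF_mem_FP fun _ => rfl

/-- `sndF` on codes. [folklore] -/
private theorem sndC : CodeFP strE strE sndF := of_fn sndF sndF_mem_FP fun _ => rfl

/-- The three fields on codes. [cite: AroraBarak2009, §1.3] -/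
theorem dOfC : CodeFP strE natE dOf := strVal.comp fstC

/-- The `a`-field on codes. [cite: AroraBarak2009, §1.3] -/
theorem aOfC : CodeFP strE natE aOf := strVal.comp (fstC.comp sndC)

/-- The `k`-field on codes. [cite: AroraBarak2009, §1.3] -/
theorem kOfC : CodeFP strE natE kOf := strVal.comp (sndC.comp sndC)

/-- Well-formedness on codes. [cite: AroraBarak2009, §1.3] -/
theorem wfC : CodeFP strE bitE wf := by
  have h3 : CodeFP strE strE (fun x => boolPair (encodeNat (dOf x)) (boolPair (encodeNat (aOf x)) (encodeNat (kOf x)))) :=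
    (dOfC.pair (aOfC.pair kOfC)).recodeOut fun _ => rfl
  exact ((beq (eα := strE) fun _ _ h => h).comp (h3.pair (CodeFP.id strE))).congr fun _ => rfl

/-- A polynomial of the length, in unary. [cite: AroraBarak2009, §1.3] -/
private theorem polyLenC (p : Polynomial ℕ) : CodeFP strE unE (fun w => p.eval w.length) :=
  of_fn (Plumb.polyFn p) (Plumb.polyFn_mem_FP p) fun w => by rw [Plumb.polyFn_apply, unE_eq_ones]; rfl

/-- The coin blocks on codes, from `(z, F)`. [cite: AroraBarak2009, §1.3] -/
theorem blocksC : CodeFP (pairE strE (rawE natE)) (rawE (rawE strE))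
    (fun t => blocks (fstF t.1) t.2.dedup.length (sndF t.1)) := by
  have hz : CodeFP (pairE strE (rawE natE)) strE (fun t => t.1) := fst _ _
  have hF : CodeFP (pairE strE (rawE natE)) (rawE natE) (fun t => t.2) := snd _ _
  have hx := fstC.comp hz
  have hc := sndC.comp hz
  have hm : CodeFP (pairE strE (rawE natE)) unE (fun t => (fstF t.1).length + 10) :=
    ((polyLenC (X + 10)).comp hx).congr fun _ => by simp
  have hμ : CodeFP (pairE strE (rawE natE)) unE (fun t => (fstF t.1).length + 3) :=
    ((polyLenC (X + 3)).comp hx).congr fun _ => by simp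
  have hℓ : CodeFP (pairE strE (rawE natE)) unE (fun t => ((fstF t.1).length + 10) * ((fstF t.1).length + 3)) :=
    ((polyLenC ((X + 10) * (X + 3))).comp hx).congr fun _ => by simp
  have hS : CodeFP (pairE strE (rawE natE)) unE (fun t => t.2.dedup.length) :=
    (ulength natE).comp ((dedup natE natE_injective).comp hF)
  have hout : CodeFP (pairE strE (rawE natE)) (rawE strE)
      (fun t => chunks t.2.dedup.length (((fstF t.1).length + 10) * ((fstF t.1).length + 3)) (sndF t.1)) :=
    (strChunks.comp (hS.pair (hℓ.pair hc))).congr fun _ => rfl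
  have hg : CodeFP (pairE (pairE unE unE) strE) (rawE strE) (fun s => chunks s.1.1 s.1.2 s.2) :=
    (strChunks.comp ((fst _ _).fst'.pair ((fst _ _).snd'.pair (snd _ _)))).congr fun _ => rfl
  have hmap := map (σ := ℕ × ℕ) (eσ := pairE unE unE) hg
  exact (hmap.comp ((hm.pair hμ).pair hout)).congr fun _ => rfl

/-- The number map on codes. [cite: AroraBarak2009, §1.3] -/
theorem numC : CodeFP strE natE num := aOfC.comp fstC

/-- `|bin (num z)| ≤ |z|`. [folklore] -/
theorem num_le (z : List Bool) : (encodeNat (num z)).length ≤ z.length := by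
  refine (length_encodeNat_bitsToNat_le _).trans ?_
  have h1 := length_fstF_sndF_le z
  have h2 := length_fstF_sndF_le (fstF z)
  have h3 := length_fstF_sndF_le (sndF (fstF z))
  omega

/-- The final query on codes. [cite: AroraBarak2009, §1.3] -/
theorem finC : CodeFP (pairE strE (rawE natE)) strE fin := by
  have hz : CodeFP (pairE strE (rawE natE)) strE (fun t => t.1) := fst _ _
  have hF : CodeFP (pairE strE (rawE natE)) (rawE natE) (fun t => t.2) := snd _ _
  have hx := fstC.comp hz
  have hd := dOfC.comp hx
  have hk := kOfC.comp hx
  have hsl := slotListC.comp ((hd.pair hF).pair blocksC)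
  exact (twQueryC.comp (hd.pair (hk.pair hsl))).congr fun _ => rfl

/-- The guard on codes. [cite: AroraBarak2009, §1.3] -/
theorem okC : CodeFP strE bitE ok := wfC.comp fstC

/-! ### Sizes -/

/-- `a` has at most `|bin a|` prime factors (with multiplicity). [folklore] -/
theorem length_primeFactorsList_le (a : ℕ) : a.primeFactorsList.length ≤ (encodeNat a).length := by
  rcases Nat.eq_zero_or_pos a with rfl | ha
  · simp
  · have h1 := List.pow_card_le_prod a.primeFactorsList 2 fun x hx => (Nat.prime_of_mem_primeFactorsList hx).two_le
    rw [Nat.prod_primeFactorsList ha.ne'] at h1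
    have h2 : a < 2 ^ (encodeNat a).length := by
      rw [TM2Pass.length_encodeNat_eq_size]; exact Nat.lt_size_self a
    have h3 := (Nat.pow_lt_pow_iff_right (by norm_num : 1 < 2)).1 (h1.trans_lt h2)
    omega

/-- The analytic inequality of the error bound: `n · (3/4)^{n+10} ≤ 1/4`. [folklore] -/
theorem mul_pow_le_quarter (n : ℕ) : (n : ℝ) * (3 / 4 : ℝ) ^ (n + 10) ≤ 1 / 4 := by
  have hB : 1 + (n : ℝ) * (1 / 3) ≤ (4 / 3 : ℝ) ^ n := by
    have := one_add_mul_le_pow (show (-2 : ℝ) ≤ 1 / 3 by norm_num) n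
    norm_num at this ⊢
    linarith
  have h34 : (4 / 3 : ℝ) ^ n * (3 / 4) ^ n = 1 := by rw [← mul_pow]; norm_num
  have h1 : (n : ℝ) * (3 / 4 : ℝ) ^ n ≤ 3 := by
    have hn : (n : ℝ) ≤ 3 * (4 / 3 : ℝ) ^ n := by linarith
    calc (n : ℝ) * (3 / 4) ^ n ≤ 3 * (4 / 3 : ℝ) ^ n * (3 / 4) ^ n := by gcongr
      _ = 3 := by rw [mul_assoc, h34, mul_one]
  calc (n : ℝ) * (3 / 4) ^ (n + 10) = (n * (3 / 4) ^ n) * (3 / 4) ^ 10 := by ring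
    _ ≤ 3 * (1 / 12) := by gcongr; norm_num
    _ = 1 / 4 := by norm_num

/-! ### The good event -/

/-- **On the good coins the machine's slot list is `withRoots (−d) (factorPairs a)`, with probability
`≥ 3/4`.** [cite: Cohen1993, §1.5.1] -/
theorem le_uniformProb_slotList_eq (d a k : ℕ) :
    3 / 4 ≤ uniformProb ((boolPair (encodeNat d) (boolPair (encodeNat a) (encodeNat k))).length *
        (((boolPair (encodeNat d) (boolPair (encodeNat a) (encodeNat k))).length + 10) *
          ((boolPair (encodeNat d) (boolPair (encodeNat a) (encodeNat k))).length + 3)))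
      {c | slotList d a.primeFactorsList (blocks (boolPair (encodeNat d) (boolPair (encodeNat a) (encodeNat k)))
          a.primeFactorsList.dedup.length c) = withRoots (-(d : ℤ)) (factorPairs a)} := by
  set x := boolPair (encodeNat d) (boolPair (encodeNat a) (encodeNat k)) with hx
  set n := x.length with hn
  set m := n + 10 with hm
  set μ := n + 3 with hμ
  set FD := a.primeFactorsList.dedup with hFD
  set S := FD.length with hS
  have hna : (encodeNat a).length ≤ n := by
    rw [hn, hx, length_boolPair, length_boolPair]; omega
  have hSn : S ≤ n :=
    ((List.dedup_sublist _).length_le.trans (length_primeFactorsList_le a)).trans hna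
  -- the bad event and its probability
  set B : ℕ → List Bool → Set (List Bool) := fun i _ => {blk | ¬ Good d (FD.getD i 0) (chunks m μ blk)} with hB
  have hbad : uniformProb (n * (m * μ)) {r | ∃ i < S, (r.drop (i * (m * μ))).take (m * μ) ∈ B i (r.take (i * (m * μ)))} ≤
      S * (3 / 4 : ℝ) ^ m := by
    refine uniformProb_exists_badBlock_le (Nat.mul_le_mul_right _ hSn) B fun i hi w _ => ?_
    have hmem : FD.getD i 0 ∈ a.primeFactorsList := by
      rw [List.getD_eq_getElem?_getD, List.getElem?_eq_getElem (hS ▸ hi), Option.getD_some]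
      exact List.mem_dedup.1 (List.getElem_mem _)
    have hprime : (FD.getD i 0).Prime := Nat.prime_of_mem_primeFactorsList hmem
    have hle : FD.getD i 0 ≤ a := Nat.le_of_mem_primeFactorsList hmem
    have ha2 : a < 2 ^ (encodeNat a).length := by
      rw [TM2Pass.length_encodeNat_eq_size]; exact Nat.lt_size_self a
    have h2n : 2 ^ (encodeNat a).length ≤ 2 ^ n := Nat.pow_le_pow_right (by norm_num) hna
    have hμq : 8 * FD.getD i 0 ≤ 2 ^ μ := by
      have h8 : 2 ^ μ = 2 ^ n * 8 := by rw [hμ, pow_add]; norm_num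
      rw [h8]; omega
    exact uniformProb_not_good_le hprime d hμq m
  -- the good event is contained in the target
  have hsub : ∀ c : List Bool, c ∈ {r | ∃ i < S, (r.drop (i * (m * μ))).take (m * μ) ∈ B i (r.take (i * (m * μ)))}ᶜ →
      c ∈ {c | slotList d a.primeFactorsList (blocks x S c) = withRoots (-(d : ℤ)) (factorPairs a)} := by
    intro c hc
    simp only [Set.mem_compl_iff, Set.mem_setOf_eq, not_exists, not_and, hB, not_not] at hc
    refine slotList_eq_withRoots a d (by simp [blocks, chunks, hS, hFD]) fun i hi => ?_
    have h := hc i (hS ▸ hFD ▸ hi)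
    rw [List.getD_eq_getElem?_getD, hFD, List.getElem?_eq_getElem hi, Option.getD_some] at h
    simpa [blocks, chunks, hn, hm, hμ] using h
  have hmono := BlockRejection.uniformProb_mono_len (m := n * (m * μ)) fun c _ hc => hsub c hc
  rw [Literature.Computability.Complexity.uniformProb_compl] at hmono
  have hS4 : (S : ℝ) * (3 / 4 : ℝ) ^ m ≤ 1 / 4 := by
    calc (S : ℝ) * (3 / 4) ^ m ≤ n * (3 / 4) ^ m := by gcongr
      _ ≤ 1 / 4 := mul_pow_le_quarter n
  linarith

/-! ### `TWBIT ∈ BQP` -/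

/-- **`TWBIT ∈ BQP` given a factor-bit language and `THREEORD` in `BQP`.** The randomized classical
machine with oracle `FB ⊕ THREEORD` (factor window, Cipolla roots from coins, one `THREEORD` query)
writes the membership bit with probability `≥ 3/4` (`le_uniformProb_slotList_eq`); the classical-base
principle `isQSolvable_of_mem_FPRel_BQP_holds` and decision from the written bit conclude.
[cite: BennettBernsteinBrassardVazirani1997, Cor. 4.15 (BQP^BQP = BQP)] -/
theorem twbLang_mem_BQP {FB : Language Bool}
    (hFBiff : ∀ (N : ℕ) (u : List Bool),
      boolPair (encodeNat N) u ∈ FB ↔ (VDSOracle.certCode N.primeFactorsList).getD u.length false = true)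
    (hFB : FB ∈ BQP) (h3 : threeOrdLang ∈ BQP) : twbLang ∈ BQP := by
  classical
  obtain ⟨T, hT, hTeq⟩ := FactorWindow.exists_transducer (CU := threeOrdLang) numC num_le finC okC hFBiff
  set bit : List Bool → Bool := fun x => decide (x ∈ twbLang) with hbit_def
  have hbit : ∀ x, bit x = true ↔ x ∈ twbLang := fun x => decide_eq_true_iff
  have hA : oracleJoin FB threeOrdLang ∈ BQP := oracleJoin_mem_BQP hFB h3
  have hsolv : IsQSolvable fun x => {z | [bit x] <+: z} := by
    refine isQSolvable_of_mem_FPRel_BQP_holds (oracleJoin FB threeOrdLang) T (X * ((X + 10) * (X + 3)))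
      (fun x => {z | [bit x] <+: z}) (fun x y hy z hyz => List.IsPrefix.trans hy hyz) hA hT fun x => ?_
    have hev : (X * ((X + 10) * (X + 3)) : Polynomial ℕ).eval x.length = x.length * ((x.length + 10) * (x.length + 3)) := by
      simp
    rw [hev]
    by_cases hw : wf x = true
    · obtain ⟨d, a, k, rfl⟩ := (wf_eq_true_iff x).1 hw
      refine (le_uniformProb_slotList_eq d a k).trans (BlockRejection.uniformProb_mono_len fun c _ hc => ?_)
      simp only [Set.mem_setOf_eq] at hc ⊢
      rw [hTeq, ok, fin, num, fstF_boolPair, sndF_boolPair, hw, Bool.true_and]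
      simp only [dOf, aOf, kOf, fstF_boolPair, sndF_boolPair, bitsToNat_encodeNat] at hc ⊢
      rw [hc]
      have : bit (boolPair (encodeNat d) (boolPair (encodeNat a) (encodeNat k))) =
          threeOrdLang.boolIndicator (twQuery d k (withRoots (-(d : ℤ)) (factorPairs a))) := by
        rw [hbit_def]
        beta_reduce
        by_cases hm : twQuery d k (withRoots (-(d : ℤ)) (factorPairs a)) ∈ threeOrdLang
        · rw [(Set.mem_iff_boolIndicator _ _).1 hm, decide_eq_true ((mem_twbLang_iff d a k).2 hm)]
        · rw [(Set.notMem_iff_boolIndicator _ _).1 hm, decide_eq_false (fun h => hm ((mem_twbLang_iff d a k).1 h))]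
      rw [this]
    · have hset : {c : List Bool | T (boolPair x c) ∈ {z | [bit x] <+: z}} = Set.univ := by
        refine Set.eq_univ_of_forall fun c => ?_
        simp only [Set.mem_setOf_eq]
        rw [hTeq, ok, fstF_boolPair, Bool.eq_false_iff.2 hw, Bool.false_and, hbit_def]
        beta_reduce
        rw [decide_eq_false (fun h => hw (wf_of_mem h))]
      rw [hset, uniformProb_univ]
      norm_num
  exact mem_BQP_of_isQSolvable_bit (fun _ _ => QCircuit.outputPMF_apply_holds) cliffordT_isUnitary_holds hbit hsolv

end TorsionWitness

end Literature.Computability.Cryptography.Hallgren2005
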